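import Summits.ResolutionOfSingularities.ResolutionOfSingularities.Theorems.EquisingularLiftEquisingularLiftNatLargeCharST
import Summits.ResolutionOfSingularities.ResolutionOfSingularities.Theorems.EquisingularLiftEquisingularLiftNatLargeCharOrdOne
import Summits.ResolutionOfSingularities.ResolutionOfSingularities.Theorems.EquisingularLiftEquisingularLiftNatResidueHypDefsE10
import Literature.AlgebraicGeometry.Resolution.KollarBlowupSequenceFunctorsProofs
import Literature.AlgebraicGeometry.Resolution.BlowupSequencesAppend
import Literature.AlgebraicGeometry.Resolution.RegularBlowup
import Literature.AlgebraicGeometry.Resolution.BlowupsIntegral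
import Literature.AlgebraicGeometry.Resolution.BlowupOffCentre
import Literature.AlgebraicGeometry.Resolution.RegularCentreBlowupOrder
import Literature.AlgebraicGeometry.Resolution.RegularCentreRsopGenerated
import Literature.AlgebraicGeometry.Resolution.KollarTripleBlowup
import Literature.AlgebraicGeometry.Resolution.KollarTripleMaxOrd
import Literature.AlgebraicGeometry.Resolution.StrictTransformSupport
import Literature.AlgebraicGeometry.Resolution.SmoothOfRegularPerfectField
import HarnessLib

/-!
# [OURS · L1 W4.5(b) · EL♮ · RUNG LC «large characteristic», brick (B2-K)] CHARACTERISTIC ZERO: EMBEDDED RESOLUTION OF A HYPERSURFACE BY BLOWING UP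
# SMOOTH CENTRES INSIDE THE RUNNING STRICT TRANSFORMS — the K-side word of the descent door, assembled from Kollár's PROVED order reduction

res-L1-w45b-stub-4 g17 (STUB WORKER 4; OFFER 2026-08-29T16:08Z under the desk's R93/R94 booking of RUNG LC; memo res-L1-w45b-idea-2 g32
`Cruxes/EquisingularLiftNatThree/LARGE-CHAR-RUNG-idea2.md` v1.1 ada089db502dd96d §2 (B2); panel res-L1-w45b-crit-3 g14 «(B2) PASS by type» 2026-08-29T15:5xZ).
Crux context EL♮(3) = stmt-ResolutionOfSingularities-20148 (parent EL♮ stmt-…-20038; bookkeeping crux stmt-…-15660).  OURS; NOT a statement of any manuscript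
([Hironaka2017] is a candidate under adjudication, nothing of it is asserted or imported); AI-written, weaker than expert review.  DEF-FREE (the currencies are
res-type-027's ✓ `DescCentresSmoothOver` / `DescTransformOK` of …DefsE10 and Literature's ✓ `CentreSeq.ExceptionalFlatOver`); no `sorry`; standard axioms;
`--supports stmt-…-20148 --as helper`, counted 0.  EL♮(3) / EL♮ / `EquisingularLift` NOT proved; this is the K-SIDE (characteristic ZERO) step of an
unfunded rung and proves nothing in positive characteristic.

WHAT.  `K` a field of characteristic `0`, `X` an integral regular scheme of finite type over `K` (e.g. `ℙⁿ_K`), `I` an effective Cartier ideal on `X`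
(a hypersurface `V(I)`), `σ : X ⟶ P` a «stage map» and `Y₀ ⊆ P` a set whose generic point (if any) has only order-`≤ 1` points of `I` over it (for the
rung: `σ = 𝟙`, `Y₀ = V(I)`, `V(I)` integral).  Then there is a multiple blow-up `t : CentreSeq X` (chosen blow-ups, Literature `BlowupSequences`) with
* `DescCentresSmoothOver t s` — every centre is SMOOTH over `Spec K`;
* `t.ExceptionalFlatOver s` — (trivially over a field) every exceptional divisor is flat over `Spec K`;
* `DescTransformOK t σ Y₀ V(I)` — every centre lies INSIDE the running strict transform of `V(I)` (as a set: `closure (π⁻¹(Y ∖ V(C)))` at each step)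
  and over the non-generic points of `Y₀`, and at the END the reduced structure on the (closed) running transform is REGULAR
(★ `LargeChar.exists_centreSeq_descTransformOK`; with an explicit bound `m ≥ max-ord I`: `…_of_forall_idealOrder_le`).
PROOF (Kollár 2007 §3 for hypersurfaces = Hironaka 1964 for hypersurfaces, the classical «blow up inside the maximal-multiplicity locus» bookkeeping):
strong induction on `m ≥ max-ord I`.  `m ≤ 1`: no blow-up, `V(I)` is regular (✓ LC-ORD1 `LargeChar.isRegular_subscheme_of_isEffectiveCartier_of_idealOrder_le_one`).
`m ≥ 2`: ONE ROUND of Kollár's order reduction for the marked ideal `(X, I, ∅, m)` — the CentreSeq-valued functor `𝓑𝓜𝓞_m` of Thm. 3.69, PROVED in the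
tree (`(Kollar2007Thm3_103.orderReduction Kollar2007Thm3_103_holds Kollar2007Thm3_107_holds n).2`, standard axioms) — gives `t₁` with centres regular and
inside `cosupp(I_i, m)` and `cosupp(I_r, m) = ∅` at the end; the lemma `LargeChar.round` transports along `t₁`: the tops stay integral (✓ `IsBlowup.isIntegral`),
regular (✓ `IsBlowup.isRegular_of_isRegular_subscheme`) and of finite type (blow-ups are proper), the marked transforms stay effective Cartier
(✓ `IsBlowup.isEffectiveCartier_controlledTransform_of_le_pow`) of maximal order `≤ m` (✓ `IsBlowup.idealOrder_controlledTransform_le_of_forall`,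
Cossart–Piltant) and ARE the strict transforms (✓ LC-ST `LargeChar.controlledTransform_eq_strictTransformIdeal_of_forall_idealOrder_le`, Kollár 3.60), whose
supports are the closures `closure (π⁻¹(V(I) ∖ V(C)))` (✓ `IsBlowup.support_strictTransformIdeal_eq_closure`); centres avoid the generic fibre of `Y₀`
(order `≤ 1 < m` there, ✓ `IsBlowup.idealOrder_controlledTransform_of_not_mem`); regular centres of finite type over the perfect `K` are smooth
(✓ `smooth_of_isRegular_of_perfectField`); then recurse with `m − 1` on the top of `t₁` and APPEND (✓ `CentreSeq.append`).
[cite: Kollar2007, Thm. 3.69 (p. 150), 3.58–3.60, proof of Cor. 3.22 (pp. 124–125)] [cite: Hironaka1964, Main Theorem I (hypersurface case)]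
[cite: BierstoneGrigorievMilmanWlodarczyk2011, §3.3] (method; index only).
-/

set_option linter.dupNamespace false -- mandated namespace `Summit.<Summit>.<Problem>` of this single-conjunct summit

noncomputable section

open CategoryTheory CategoryTheory.Limits AlgebraicGeometry TopologicalSpace Topology IsLocalRing
open Literature.AlgebraicGeometry.Resolution
open AlgebraicGeometry.Scheme.IdealSheafData

namespace Summit.ResolutionOfSingularities.ResolutionOfSingularities.Cruxes.EquisingularLiftNat.Sections

namespace LargeChar

/-! ## Small helpers -/

/-- Every morphism to the spectrum of a field is flat. [folklore] -/
theorem flat_of_field {K : Type} [Field K] {Z : Scheme.{0}} (f : Z ⟶ Spec (.of K)) : Flat f := by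
  rw [IsZariskiLocalAtSource.iff_of_openCover (P := @Flat) Z.affineCover]
  intro i
  obtain ⟨φ, hφ⟩ := Spec.map_surjective (Z.affineCover.f i ≫ f)
  have hflat : Flat (Spec.map φ) := by
    rw [HasRingHomProperty.Spec_iff (P := @Flat)]
    exact RingHom.Flat.of_isField (Field.toIsField K) _
  rwa [hφ] at hflat

/-- An effective Cartier ideal on a locally Noetherian scheme has nowhere-dense support. [cite: StacksProject, Tag 01WS] -/
theorem interior_support_eq_empty_of_isEffectiveCartier {X : Scheme.{0}} [IsLocallyNoetherian X] {I : X.IdealSheafData}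
    (hI : IsEffectiveCartier I) : interior (I.support : Set X) = ∅ :=
  interior_eq_empty_iff_dense_compl.mpr hI.dense_compl_support

/-- The stalks of an effective Cartier ideal are nonzero (they are generated by nonzerodivisors of nontrivial local rings). [folklore] -/
theorem stalkIdeal_ne_bot_of_isEffectiveCartier {X : Scheme.{0}} {I : X.IdealSheafData} (hI : IsEffectiveCartier I) (x : X) :
    stalkIdeal I x ≠ ⊥ := by
  obtain ⟨t, ht0, ht⟩ := hI.exists_stalkIdeal_eq_span x
  rw [ht, Ne, Ideal.span_singleton_eq_bot]
  exact nonZeroDivisors.ne_zero ht0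

/-- A centre inside the support of an effective Cartier ideal of a non-empty locally Noetherian scheme is not the zero ideal. [folklore] -/
theorem centre_ne_bot {X : Scheme.{0}} [IsLocallyNoetherian X] [Nonempty X] {I C : X.IdealSheafData} (hI : IsEffectiveCartier I)
    (hCI : (C.support : Set X) ⊆ I.support) : C ≠ ⊥ := by
  intro hC
  have huniv : (I.support : Set X) = Set.univ := by
    refine Set.eq_univ_of_univ_subset ?_
    have : ((⊥ : X.IdealSheafData).support : Set X) = Set.univ := by rw [support_bot]; rfl
    rw [← this, ← hC]
    exact hCI
  have h := interior_support_eq_empty_of_isEffectiveCartier hI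
  rw [huniv, interior_univ] at h
  exact Set.empty_ne_univ.symm h |>.elim

/-- ORDLE (Cossart–Piltant Prop. 4.2 (a), tree ✓ `IsBlowup.idealOrder_controlledTransform_le_of_forall`) for a regular centre given by an arbitrary
ideal `C` (not syntactically a vanishing ideal): if `ord_y J = μ` on `V(C)` and `ord ≤ μ` everywhere then the controlled transform has `ord ≤ μ`
everywhere. [cite: CossartPiltant2008, proof of Prop. 4.2 (a)] -/
theorem idealOrder_controlledTransform_le_of_forall' {X X' : Scheme.{0}} [IsLocallyNoetherian X] [IsLocallyNoetherian X'] {π : X' ⟶ X}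
    (hX : Scheme.IsRegular X) {C : X.IdealSheafData} (hC : Scheme.IsRegular C.subscheme) (hπ : IsBlowup π C) {J : X.IdealSheafData} {μ : ℕ}
    (hY : ∀ y ∈ C.support, idealOrder J y = μ) (hJ : ∀ x, idealOrder J x ≤ μ) (x' : X') :
    idealOrder (controlledTransform π C J μ) x' ≤ μ := by
  obtain ⟨D, rfl⟩ : ∃ D : Closeds X, C = vanishingIdeal D := ⟨_, eq_vanishingIdeal_support_of_isRegular C hC⟩
  have hD : ((vanishingIdeal D).support : Set X) = D := Scheme.IdealSheafData.coe_support_vanishingIdeal D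
  exact hπ.idealOrder_controlledTransform_le_of_forall hX hC (fun y hy => hY y (by rw [← hD] at hy; exact hy)) hJ x'

/-! ## One Kollár round, transported: the invariants of the recursion travel along an admissible sequence -/

variable {K : Type} [Field K] [CharZero K] {P : Scheme.{0}} (Y₀ : Set P)

/-- **The round lemma.**  Along a multiple blow-up `t` ADMISSIBLE for the marked ideal `M = (X, I, E, m)` (centres regular, inside `cosupp(I_i, m)`) of an
integral regular `X` of finite type over the characteristic-zero field `K`, with `I` effective Cartier of maximal order `≤ m`, `m ≥ 2`, and a stage map
`σ : X ⟶ P` whose points over the generic point of `Y₀` have order `≤ 1`: the top of `t` is again integral, regular, of finite type; the marked transform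
`I_r` is effective Cartier of maximal order `≤ m`, with order `≤ 1` over the generic point of `Y₀`; and `t` is a GOOD PREFIX for the three door
currencies — smooth centres, flat exceptional divisors, and `DescTransformOK` with running set `V(I_r)` = the iterated strict transform of `V(I)`.
[cite: Kollar2007, 3.58–3.60 and Thm. 3.69] -/
theorem round :
    ∀ {X : Scheme.{0}} (t : CentreSeq X) (s : X ⟶ Spec (.of K)) [LocallyOfFiniteType s] [QuasiCompact s] [IsIntegral X]
      (_hreg : Scheme.IsRegular X) (M : MarkedIdeal X) (_hM : IsEffectiveCartier M.ideal)
      (_hmax : ∀ x, idealOrder M.ideal x ≤ M.mult) (_hm : 2 ≤ M.mult) (σ : X ⟶ P)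
      (_hgen : ∀ x, IsGenericPoint (σ x) Y₀ → idealOrder M.ideal x ≤ 1) (_hadm : t.IsAdmissibleFor M),
      IsIntegral t.top ∧ Scheme.IsRegular t.top ∧ LocallyOfFiniteType (t.comp ≫ s) ∧ QuasiCompact (t.comp ≫ s) ∧
      IsEffectiveCartier (t.transformMarked M).ideal ∧ (∀ x, idealOrder (t.transformMarked M).ideal x ≤ M.mult) ∧
      (∀ x, IsGenericPoint ((t.comp ≫ σ) x) Y₀ → idealOrder (t.transformMarked M).ideal x ≤ 1) ∧
      (∀ t₂ : CentreSeq t.top, DescCentresSmoothOver t₂ (t.comp ≫ s) → DescCentresSmoothOver (t.append t₂) s) ∧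
      (∀ t₂ : CentreSeq t.top, t₂.ExceptionalFlatOver (t.comp ≫ s) → (t.append t₂).ExceptionalFlatOver s) ∧
      (∀ t₂ : CentreSeq t.top, DescTransformOK t₂ (t.comp ≫ σ) Y₀ (((t.transformMarked M).ideal.support : Set t.top)) →
          DescTransformOK (t.append t₂) σ Y₀ (M.ideal.support : Set X))
  | X, .nil _, s, _, _, _, hreg, M, hM, hmax, hm, σ, hgen, _ => by
    show IsIntegral X ∧ Scheme.IsRegular X ∧ LocallyOfFiniteType (𝟙 X ≫ s) ∧ QuasiCompact (𝟙 X ≫ s) ∧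
      IsEffectiveCartier M.ideal ∧ (∀ x, idealOrder M.ideal x ≤ M.mult) ∧
      (∀ x : X, IsGenericPoint ((𝟙 X ≫ σ) x) Y₀ → idealOrder M.ideal x ≤ 1) ∧
      (∀ t₂ : CentreSeq X, DescCentresSmoothOver t₂ (𝟙 X ≫ s) → DescCentresSmoothOver t₂ s) ∧
      (∀ t₂ : CentreSeq X, t₂.ExceptionalFlatOver (𝟙 X ≫ s) → t₂.ExceptionalFlatOver s) ∧
      (∀ t₂ : CentreSeq X, DescTransformOK t₂ (𝟙 X ≫ σ) Y₀ (M.ideal.support : Set X) →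
        DescTransformOK t₂ σ Y₀ (M.ideal.support : Set X))
    simp only [Category.id_comp]
    exact ⟨‹_›, hreg, ‹_›, ‹_›, hM, hmax, hgen, fun _ h => h, fun _ h => h, fun _ h => h⟩
  | X, .cons C rest, s, _, _, _, hreg, M, hM, hmax, hm, σ, hgen, hadm => by
    obtain ⟨hCsupp, -, hC, hrest⟩ := hadm
    haveI : IsLocallyNoetherian X := LocallyOfFiniteType.isLocallyNoetherian s
    have hπ : IsBlowup (blowup.π C) C := blowup.isBlowup C
    haveI : IsLocallyNoetherian (blowup C) := hπ.isLocallyNoetherian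
    haveI : IsProper (blowup.π C) := hπ.isProper
    haveI : LocallyOfFiniteType (blowup.π C ≫ s) := inferInstance
    haveI : QuasiCompact (blowup.π C ≫ s) := inferInstance
    have hm1 : 1 ≤ M.mult := by omega
    -- the centre lies in `V(I)`, which is nowhere dense; so the centre is nowhere dense and nonzero
    have hIint : interior (M.ideal.support : Set X) = ∅ := interior_support_eq_empty_of_isEffectiveCartier hM
    have hCI : (C.support : Set X) ⊆ M.ideal.support := hCsupp.trans (M.support_subset_support_ideal hm1)
    have hint : interior (C.support : Set X) = ∅ :=
      Set.eq_empty_of_subset_empty (hIint ▸ interior_mono hCI)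
    haveI : Nonempty X := ⟨genericPoint X⟩
    have hC0 : C ≠ ⊥ := centre_ne_bot hM hCI
    -- the blown-up scheme
    haveI : IsIntegral (blowup C) := hπ.isIntegral hC0
    have hreg' : Scheme.IsRegular (blowup C) := IsBlowup.isRegular_of_isRegular_subscheme hreg hC hπ
    -- orders on the centre are exactly `m`
    have hge : ∀ y ∈ C.support, (M.mult : ℕ∞) ≤ idealOrder M.ideal y := fun y hy => hCsupp hy
    have heq : ∀ y ∈ C.support, idealOrder M.ideal y = M.mult := fun y hy => le_antisymm (hmax y) (hge y hy)
    have hle : M.ideal ≤ C ^ M.mult := le_pow_of_isRegular_subscheme_of_forall_le_idealOrder_of_isRegular hreg hC hge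
    -- the transform: effective Cartier, max-ord ≤ m, = strict transform, support = closure
    have hM' : IsEffectiveCartier (M.transform (blowup.π C) C).ideal :=
      hπ.isEffectiveCartier_controlledTransform_of_le_pow hM hle
    have hmax' : ∀ x', idealOrder (M.transform (blowup.π C) C).ideal x' ≤ (M.transform (blowup.π C) C).mult := fun x' =>
      idealOrder_controlledTransform_le_of_forall' hreg hC hπ heq hmax x'
    have hST : (M.transform (blowup.π C) C).ideal = strictTransformIdeal (blowup.π C) C M.ideal :=
      controlledTransform_eq_strictTransformIdeal_of_forall_idealOrder_le hreg hC hint hπ hM hmax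
    have hsuppST : (((M.transform (blowup.π C) C).ideal).support : Set (blowup C)) =
        closure ((blowup.π C) ⁻¹' ((M.ideal.support : Set X) \ (C.support : Set X))) := by
      rw [hST]
      exact hπ.support_strictTransformIdeal_eq_closure M.ideal
    -- the generic fibre of `Y₀` is untouched
    have hgen' : ∀ x', IsGenericPoint ((blowup.π C ≫ σ) x') Y₀ → idealOrder (M.transform (blowup.π C) C).ideal x' ≤ 1 := by
      intro x' hx'
      rw [Scheme.Hom.comp_apply] at hx'
      have hnot : (blowup.π C) x' ∉ (C.support : Set X) := by
        intro hmem
        have h1 := hgen _ hx'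
        have h2 := hge _ hmem
        have h3 : ((M.mult : ℕ) : ℕ∞) ≤ 1 := h2.trans h1
        have : M.mult ≤ 1 := by exact_mod_cast h3
        omega
      rw [MarkedIdeal.transform_ideal, hπ.idealOrder_controlledTransform_of_not_mem M.ideal M.mult hnot]
      exact hgen _ hx'
    -- the induction hypothesis along the rest, over `blowup.π C ≫ s`
    obtain ⟨hint₁, hreg₁, hloft₁, hqc₁, hM₁, hmax₁, hgen₁, hsm₁, hfl₁, hok₁⟩ :=
      round rest (blowup.π C ≫ s) hreg' (M.transform (blowup.π C) C) hM' hmax' hm (blowup.π C ≫ σ) hgen' hrest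
    show IsIntegral rest.top ∧ Scheme.IsRegular rest.top ∧ LocallyOfFiniteType ((rest.comp ≫ blowup.π C) ≫ s) ∧
      QuasiCompact ((rest.comp ≫ blowup.π C) ≫ s) ∧
      IsEffectiveCartier (rest.transformMarked (M.transform (blowup.π C) C)).ideal ∧
      (∀ x, idealOrder (rest.transformMarked (M.transform (blowup.π C) C)).ideal x ≤ M.mult) ∧
      (∀ x : rest.top, IsGenericPoint (((rest.comp ≫ blowup.π C) ≫ σ) x) Y₀ →
        idealOrder (rest.transformMarked (M.transform (blowup.π C) C)).ideal x ≤ 1) ∧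
      (∀ t₂ : CentreSeq rest.top, DescCentresSmoothOver t₂ ((rest.comp ≫ blowup.π C) ≫ s) →
        DescCentresSmoothOver (CentreSeq.cons C (rest.append t₂)) s) ∧
      (∀ t₂ : CentreSeq rest.top, t₂.ExceptionalFlatOver ((rest.comp ≫ blowup.π C) ≫ s) →
        (CentreSeq.cons C (rest.append t₂)).ExceptionalFlatOver s) ∧
      (∀ t₂ : CentreSeq rest.top, DescTransformOK t₂ ((rest.comp ≫ blowup.π C) ≫ σ) Y₀
          ((rest.transformMarked (M.transform (blowup.π C) C)).ideal.support : Set rest.top) →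
        DescTransformOK (CentreSeq.cons C (rest.append t₂)) σ Y₀ (M.ideal.support : Set X))
    simp only [Category.assoc]
    refine ⟨hint₁, hreg₁, hloft₁, hqc₁, hM₁, hmax₁, hgen₁, ?_, ?_, ?_⟩
    · intro t₂ h₂
      simp only [DescCentresSmoothOver]
      refine ⟨?_, hsm₁ t₂ h₂⟩
      haveI : LocallyOfFiniteType (C.subschemeι ≫ s) := inferInstance
      exact smooth_of_isRegular_of_perfectField (C.subschemeι ≫ s) hC
    · intro t₂ h₂
      simp only [CentreSeq.ExceptionalFlatOver]
      exact ⟨flat_of_field _, hfl₁ t₂ h₂⟩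
    · intro t₂ h₂
      simp only [DescTransformOK]
      refine ⟨hCI, ?_, ?_⟩
      · rintro _ ⟨c, hc, rfl⟩ hgenc
        have h1 := hgen c hgenc
        have h2 := hge c hc
        have h3 : ((M.mult : ℕ) : ℕ∞) ≤ 1 := h2.trans h1
        have : M.mult ≤ 1 := by exact_mod_cast h3
        omega
      · rw [← hsuppST]
        exact hok₁ t₂ h₂

/-! ## The main theorem -/

/-- **(B2-K) with an explicit bound `m ≥ max-ord I`.**  By strong induction on `m`: `m ≤ 1` — no blow-up, `V(I)` regular (LC-ORD1); `m ≥ 2` — one round of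
Kollár's PROVED order reduction `𝓑𝓜𝓞_m(X, I, ∅)` (CentreSeq-valued, Thm. 3.69), transported by `round`, then the induction hypothesis at `m − 1` on its
top, appended. [cite: Kollar2007, Thm. 3.69 (p. 150) and 3.58–3.60] -/
theorem exists_centreSeq_descTransformOK_of_forall_idealOrder_le :
    ∀ (m : ℕ) {X : Scheme.{0}} (s : X ⟶ Spec (.of K)) [LocallyOfFiniteType s] [QuasiCompact s] [IsIntegral X]
      (_hreg : Scheme.IsRegular X) {I : X.IdealSheafData} (_hI : IsEffectiveCartier I) (_hmax : ∀ x, idealOrder I x ≤ m)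
      (σ : X ⟶ P) (_hgen : ∀ x, IsGenericPoint (σ x) Y₀ → idealOrder I x ≤ 1),
      ∃ t : CentreSeq X, DescCentresSmoothOver t s ∧ t.ExceptionalFlatOver s ∧ DescTransformOK t σ Y₀ (I.support : Set X) := by
  intro m
  induction m using Nat.strong_induction_on with
  | _ m ih =>
    intro X s _ _ _ hreg I hI hmax σ hgen
    haveI : IsLocallyNoetherian X := LocallyOfFiniteType.isLocallyNoetherian s
    by_cases hm : m ≤ 1
    · -- no blow-up: `V(I)` is already regular
      refine ⟨.nil X, trivial, trivial, ?_⟩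
      simp only [DescTransformOK]
      have h1 : ∀ x : X, idealOrder I x ≤ 1 := fun x => (hmax x).trans (by exact_mod_cast hm)
      have hregI : Scheme.IsRegular I.subscheme := isRegular_subscheme_of_isEffectiveCartier_of_idealOrder_le_one hreg hI h1
      have hcl : (⟨closure (I.support : Set X), isClosed_closure⟩ : Closeds X) = I.support :=
        Closeds.ext (I.support.isClosed.closure_eq)
      rw [hcl, ← eq_vanishingIdeal_support_of_isRegular I hregI]
      exact hregI
    · -- one Kollár round with marking `m ≥ 2`, then recurse
      have hm2 : 2 ≤ m := by omega
      obtain ⟨n, hn⟩ := exists_equidim_of_isIntegral s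
      let T : Kollar2007.Triple K n :=
        { X := X, struct := s, isRegular := hreg, equidim := hn, ideal := I,
          stalkIdeal_ne_bot := stalkIdeal_ne_bot_of_isEffectiveCartier hI, boundary := [],
          hasSNC := hasSNC_nil_of_isRegular hreg, boundary_pairwise := List.Pairwise.nil }
      obtain ⟨B, hB, -, -, -⟩ :=
        (Kollar2007Thm3_103.orderReduction Kollar2007Thm3_103_holds Kollar2007Thm3_107_holds n).2 m (by omega)
      obtain ⟨hres, -⟩ := hB T
      obtain ⟨hint₁, hreg₁, hloft₁, hqc₁, hM₁, -, hgen₁, hsm₁, hfl₁, hok₁⟩ :=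
        round Y₀ (B T) s hreg (T.marked m) hI hmax hm2 σ hgen hres.1
      -- after the round the maximal order dropped below `m`
      have hmax₁ : ∀ x, idealOrder ((B T).transformMarked (T.marked m)).ideal x ≤ (m - 1 : ℕ) := by
        intro x
        have hempty := hres.2
        have hx : x ∉ ((B T).transformMarked (T.marked m)).support := by rw [hempty]; exact fun h => h
        have hlt : ¬ ((m : ℕ) : ℕ∞) ≤ idealOrder ((B T).transformMarked (T.marked m)).ideal x := by
          intro h
          apply hx
          have hmult : ((B T).transformMarked (T.marked m)).mult = m := by
            rw [CentreSeq.transformMarked_mult]; rfl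
          show (((B T).transformMarked (T.marked m)).mult : ℕ∞) ≤ _
          rw [hmult]; exact h
        have hfin : idealOrder ((B T).transformMarked (T.marked m)).ideal x < ⊤ :=
          lt_of_lt_of_le (not_le.mp hlt) le_top
        obtain ⟨j, hj⟩ := ENat.ne_top_iff_exists.mp hfin.ne
        rw [← hj] at hlt ⊢
        have : ¬ m ≤ j := fun h => hlt (by exact_mod_cast h)
        exact_mod_cast (show j ≤ m - 1 by omega)
      haveI := hint₁
      haveI := hloft₁
      haveI := hqc₁
      obtain ⟨t₂, h1, h2, h3⟩ := ih (m - 1) (by omega) ((B T).comp ≫ s) hreg₁ hM₁ hmax₁ ((B T).comp ≫ σ) hgen₁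
      exact ⟨(B T).append t₂, hsm₁ t₂ h1, hfl₁ t₂ h2, hok₁ t₂ h3⟩

/-- **Maximal order exists** for an effective Cartier ideal on an integral regular scheme of finite type over a characteristic-zero field (the tree's
`Kollar2007.Triple.exists_maxOrd_eq_nat` on the triple `(X, I, ∅)`). [cite: Kollar2007, Def. 3.47 (p. 137)] -/
theorem exists_forall_idealOrder_le {X : Scheme.{0}} (s : X ⟶ Spec (.of K)) [LocallyOfFiniteType s] [QuasiCompact s] [IsIntegral X]
    (hreg : Scheme.IsRegular X) {I : X.IdealSheafData} (hI : IsEffectiveCartier I) : ∃ m : ℕ, ∀ x, idealOrder I x ≤ m := by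
  haveI : IsLocallyNoetherian X := LocallyOfFiniteType.isLocallyNoetherian s
  obtain ⟨n, hn⟩ := exists_equidim_of_isIntegral s
  let T : Kollar2007.Triple K n :=
    { X := X, struct := s, isRegular := hreg, equidim := hn, ideal := I,
      stalkIdeal_ne_bot := stalkIdeal_ne_bot_of_isEffectiveCartier hI, boundary := [],
      hasSNC := hasSNC_nil_of_isRegular hreg, boundary_pairwise := List.Pairwise.nil }
  obtain ⟨μ, hμ⟩ := T.exists_maxOrd_eq_nat I (stalkIdeal_ne_bot_of_isEffectiveCartier hI)
  exact ⟨μ, fun x => by have := maxOrd_le_iff.mp (le_of_eq hμ) x; exact this⟩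

/-- ★ **(B2-K) — CHARACTERISTIC ZERO: EMBEDDED RESOLUTION OF A HYPERSURFACE BY SMOOTH CENTRES INSIDE THE RUNNING STRICT TRANSFORMS, in the currencies
of the descent door.**  `K` of characteristic `0`; `X` integral, regular, of finite type over `K`; `I` effective Cartier; `σ : X ⟶ P`, `Y₀ ⊆ P` with
order `≤ 1` over the generic point of `Y₀`.  Then some `t : CentreSeq X` has `K`-smooth centres, `K`-flat exceptional divisors, and
`DescTransformOK t σ Y₀ V(I)`: centres inside the running strict transforms and off the generic fibre of `Y₀`, END regular.
[cite: Kollar2007, Thm. 3.69 (p. 150), 3.58–3.60; proof of Cor. 3.22] [cite: Hironaka1964, Main Theorem I] -/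
theorem exists_centreSeq_descTransformOK {X : Scheme.{0}} (s : X ⟶ Spec (.of K)) [LocallyOfFiniteType s] [QuasiCompact s] [IsIntegral X]
    (hreg : Scheme.IsRegular X) {I : X.IdealSheafData} (hI : IsEffectiveCartier I) (σ : X ⟶ P)
    (hgen : ∀ x, IsGenericPoint (σ x) Y₀ → idealOrder I x ≤ 1) :
    ∃ t : CentreSeq X, DescCentresSmoothOver t s ∧ t.ExceptionalFlatOver s ∧ DescTransformOK t σ Y₀ (I.support : Set X) := by
  obtain ⟨m, hm⟩ := exists_forall_idealOrder_le s hreg hI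
  exact exists_centreSeq_descTransformOK_of_forall_idealOrder_le Y₀ m s hreg hI hm σ hgen

end LargeChar

end Summit.ResolutionOfSingularities.ResolutionOfSingularities.Cruxes.EquisingularLiftNat.Sections

end
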